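import Literature.MathematicalPhysics.QuantumFieldTheory.Balaban1983to89.B6Ineq2134TransposeDiag
import Literature.MathematicalPhysics.QuantumFieldTheory.Balaban1983to89.B6Ineq2134KFamKLevelTorusIn
import Literature.MathematicalPhysics.QuantumFieldTheory.Balaban1983to89.B6Eq291Transpose

/-!
# `Balaban1983to89.B6Ineq2134TransposeKLevelTorus` — T. Bałaban, *Propagators and renormalization transformations for lattice gauge theories. II*,
# Commun. Math. Phys. **96** (1984) 223–250 [Balaban1984PropagatorsII], (2.134)–(2.135) p. 247 FOR THE REVERSED FAMILY `h_{□′}G_{□′}K̃_{□,□′}` ON THE GENUINE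
# MULTI-LEVEL TORUS — the generic bounds of `…B6Ineq2134TransposeDiag` packaged on the torus census geometry `geomTB D` with ONE threshold and ONE `Θ`,
# the printed `O(M⁻¹)` explicit, the localisation indicators `1_{□̃′}(y)·1_{□̃}(y′)` displayed (the shape the mirror gluing consumes)

statement-level skeleton of published theorems with citation tags; proofs where landed; nothing here is a claim about the Yang–Mills mass gap

PDF held: `paper:balaban1984-cmp96-propagators-rt-ii` (journal page = PDF page + 222); p. 247 [PDF 25] ((2.133)–(2.136)), p. 239 [PDF 17] ((2.91)–(2.93)), p. 234
[PDF 12] (Lemma 2.1) re-read this generation; the torus plumbing is read from p38 gen 25–27's `…B6Ineq2134KLevelTorus` / `…DiagKLevelTorus` /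
`…KFamKLevelTorusIn` (thresholds `ineq263_geomTB`, `thr_geomTB`, the facts `one_le_L_TB` … `levelSepTB`, the packagings `theta_le`, `theta0_joint_lt`).

CITATION HEADER (lean-in-tree rule) — WHAT IS REPRODUCED.  Phase-2 file of the `lit-balaban` typed skeleton (HOME `run/shared/lean/pub/lit-balaban/`), seat
**p38 gen 31**, brick 4 of the programme «(2.136)₃ by the transposed walk» (bricks 1–3: `…B6Prop26RightChainGeneric`, `…B6Eq291Transpose`,
`…B6Ineq2134TransposeDiag`); SKELETON rows **B6.Eq2.134** × B6.Eq2.135 × B6.Eq2.92 × B6.Eq2.93 × B6.Prop2.6 (cells only; decls of record untouched).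
THIS FILE = the torus port of the reversed (2.134):
* §1 `thetaT_pack_le` — the scalar packaging `θ_diagᵀ ≤ Θ·U/M` (`Θ = L²(c²(8/δ + 1) + 1)`, `U = #E·s₁C₁ + s₂C_G + (#K+1)·s·((C_N+1)C_H(1+r₀)) + C_DC_H/c_D`);
* §2 **`ineq2134T_kDiag_torus`** — the reversed diagonal term `h_□G_□K̃_{□,□}` with `K̃_{□,□} = kDiagT` BY NAME (`…B6Eq291Transpose`), from the INPUT-side
  decomposition `hdecT : M_□h_□ − h_□M_□ = (Σ_e E_e·c_e − c₀) + Σ_k (h_□N_k − N_kh_□)z_k` (the transpose of p38 gen 29's `hdec`), the cube's local legs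
  `G_□`, `G_□∘E_e` ((2.133)-shape, output prefactor), the global OUT-leg `h_□G_□`, the partners `N_k`, `P_□` In/Out-localised, the transposed line 3
  `h_□(∂P∂* − P_□)ζ_□`, and the input localisations (`InLoc (h_□M_□) □̃` — the transpose of p38's `hMout` —, `supp ζ_□ ⊂ □̃`):
  `HasMajorant blk (h_□G_□K̃_{□,□}) (1_{□̃}(y)1_{□̃}(y′)·Θ·U·M⁻¹·e^{−(δ/2)d})` above ONE threshold;
* §3 **`ineq2134T_kOff_torus`** — the reversed off-diagonal term `h_{□′}G_{□′}K̃_{□,□′}`, `K̃_{□,□′} = kOffT` BY NAME: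
  `HasMajorant blk (h_{□′}G_{□′}K̃_{□,□′}) (1_{□̃′}(y)1_{□̃}(y′)·Θ·C_PC_H/(mM)·e^{−(δ/2)d})`;
* §4 **`h2134T_kFamT_torus`** — ALL pairs of the reversed family with ONE threshold `M₀` and ONE `Θ`: `θ₀ = Θ·(C_PC_H/m + U)/M`;
* §5 `inputs2134T_kFamT_torus` — the same together with the smallness `N²θ₀c₁ < 1` above one threshold (p38 gen 25's `theta0_joint_lt`).
THEOREMS ONLY (no `def`, no `def … : Prop`, no new hypothesis-shaped fact); standard axioms.

HONEST SCOPE / DIVERGENCES.  As the direct torus files: per-cube inputs displayed as hypotheses of the printed shapes; `∂P∂*` a hypothesis; lattice units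
`η = 1`; constants depend on `d, L, δ` only (not on `k`, `M_h`); integer torus; Lemma 2.1 as repaired.  New w.r.t. the direct route: the global OUT-leg `h_□G_□`
(p22's `hGout_cube`), the right legs `G_□∘E_e` (p22's `hGEin_cube`), the input-side decomposition `hdecT` and the input localisations — the consumer's
(the V1 mirror skeleton).  The gap hypothesis is read from the inside out (`y″ ∈ S`, `b ∉ Score`).  Nothing on d = 4 or the continuum; NOT summit progress.
Unit `lit-balaban-p38` (gen 31), 2026-08-23.
-/

namespace Literature.MathematicalPhysics.QuantumFieldTheory.Balaban1983to89.B6Ineq2134TransposeKLevelTorus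

open Literature.MathematicalPhysics.QuantumFieldTheory.Balaban1983to89.B6MultiLevelTorusOperator (TDomains)
open Literature.MathematicalPhysics.QuantumFieldTheory.Balaban1983to89.B8Ineq192MultiLevelTorus (geomTB geomTB_L geomTB_M levelSepTB)
open Literature.MathematicalPhysics.QuantumFieldTheory.Balaban1983to89.B6Ineq261LevelGap (K261 K261_nonneg)
open Literature.MathematicalPhysics.QuantumFieldTheory.Balaban1983to89.B6RandomWalk (HasMajorant BlockSupp hasMajorant_mono)
open Literature.MathematicalPhysics.QuantumFieldTheory.Balaban1983to89.B6Prop26Gluing (mulOp mulOp_apply LocalMajorant InLoc inLoc_mul_mulOp inLoc_mul ind ind_nonneg)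
open Literature.MathematicalPhysics.QuantumFieldTheory.Balaban1983to89.B6Ineq268 (LevelSep)
open Literature.MathematicalPhysics.QuantumFieldTheory.Balaban1983to89.B6Lemma21Repaired (Ineq263With)
open Literature.MathematicalPhysics.QuantumFieldTheory.Balaban1983to89.B6InMajorantTransplant (InMajorant)
open Literature.MathematicalPhysics.QuantumFieldTheory.Balaban1983to89.B6Ineq2134OffDiag (theta_le)
open Literature.MathematicalPhysics.QuantumFieldTheory.Balaban1983to89.B6Ineq2134KLevelTorus
  (one_le_L_TB eta_pos_TB M_pos_TB one_le_RLMh RM_nonneg_TB dist_nonneg_TB ineq263_geomTB thr_geomTB)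
open Literature.MathematicalPhysics.QuantumFieldTheory.Balaban1983to89.B6Ineq2134KFamKLevel (theta0_joint_lt)
open Literature.MathematicalPhysics.QuantumFieldTheory.Balaban1983to89.B6Ineq2134TransposeDiag
  (diagT_hasMajorant compactT_inLoc hasMajorant_indOutIn offDiagT_hasMajorant_ind)
open Literature.MathematicalPhysics.QuantumFieldTheory.Balaban1983to89.B6Eq291Transpose (kDiagT kOffT kFamT kFamT_of_eq kFamT_of_ne)

variable {d ℓ : ℕ}

/-! ## §1  The scalar packaging `θ_diagᵀ ≤ Θ·U/M` -/

/-- `e^{−t} ≤ t⁻¹` for `t > 0`. [cite: Balaban1984PropagatorsII, (2.134) p.247 («O(M^{−1})»), bookkeeping] -/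
private theorem exp_neg_le_inv' {t : ℝ} (ht : 0 < t) : Real.exp (-t) ≤ t⁻¹ := by
  rw [Real.exp_neg]
  exact inv_anti₀ ht (by linarith [Real.add_one_le_exp t])

/-- THE SCALAR PACKAGING of the reversed diagonal constant: `θ_diagᵀ = (n_Es₁C₁ + s₂C_G)L²/M + (n_K+1)(s/M)C_NC_HL²(8/δ+r₀)c² + C_De^{−c_DM}C_HL²c²
≤ L²(c²(8/δ+1) + 1)·(n_Es₁C₁ + s₂C_G + (n_K+1)·s·((C_N+1)C_H(1+r₀)) + C_DC_H/c_D)·M⁻¹` (`8/δ + r₀ ≤ (8/δ+1)(1+r₀)`, `e^{−c_DM} ≤ (c_DM)⁻¹`).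
[cite: Balaban1984PropagatorsII, (2.134) p.247 («O(M^{−1})»), bookkeeping] -/
theorem thetaT_pack_le {L c CN CG CH C₁ CD cD s s₁ s₂ r₀ δ M : ℝ} (nE nK : ℕ) (hM : 0 < M) (hδ : 0 < δ)
    (hCN : 0 ≤ CN) (hCG : 0 ≤ CG) (hCH : 0 ≤ CH) (hC₁ : 0 ≤ C₁) (hCD : 0 ≤ CD) (hcD : 0 < cD)
    (hs : 0 ≤ s) (hs₁ : 0 ≤ s₁) (hs₂ : 0 ≤ s₂) (hr₀ : 0 ≤ r₀) :
    (nE * (s₁ * C₁) + s₂ * CG) * L ^ 2 / M + (nK + 1) * (s / M * (CN * CH * L ^ 2 * (8 / δ + r₀)) * c ^ 2) +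
        CD * Real.exp (-(cD * M)) * CH * L ^ 2 * c ^ 2 ≤
      L ^ 2 * (c ^ 2 * (8 / δ + 1) + 1) *
        (nE * (s₁ * C₁) + s₂ * CG + (nK + 1) * s * ((CN + 1) * CH * (1 + r₀)) + CD * CH / cD) * M⁻¹ := by
  have h8 : 8 / δ + r₀ ≤ (8 / δ + 1) * (1 + r₀) := by
    have h0 : 0 ≤ 8 / δ := by positivity
    nlinarith [mul_nonneg h0 hr₀]
  have hA0 : 0 ≤ c ^ 2 * (8 / δ + 1) := by positivity
  have hA1 : 1 ≤ c ^ 2 * (8 / δ + 1) + 1 := by linarith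
  have hL2 : 0 ≤ L ^ 2 := sq_nonneg _
  -- term 1
  have h1 : (nE * (s₁ * C₁) + s₂ * CG) * L ^ 2 / M ≤ L ^ 2 * (c ^ 2 * (8 / δ + 1) + 1) * (nE * (s₁ * C₁) + s₂ * CG) * M⁻¹ := by
    have h0 : 0 ≤ (nE : ℝ) * (s₁ * C₁) + s₂ * CG := by positivity
    rw [div_eq_mul_inv]
    have : (nE * (s₁ * C₁) + s₂ * CG) * L ^ 2 ≤ L ^ 2 * (c ^ 2 * (8 / δ + 1) + 1) * (nE * (s₁ * C₁) + s₂ * CG) := by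
      calc ((nE : ℝ) * (s₁ * C₁) + s₂ * CG) * L ^ 2 = L ^ 2 * 1 * (nE * (s₁ * C₁) + s₂ * CG) := by ring
        _ ≤ L ^ 2 * (c ^ 2 * (8 / δ + 1) + 1) * (nE * (s₁ * C₁) + s₂ * CG) :=
            mul_le_mul_of_nonneg_right (mul_le_mul_of_nonneg_left hA1 hL2) h0
    exact mul_le_mul_of_nonneg_right this (inv_nonneg.2 hM.le)
  -- term 2
  have h2 : (nK + 1) * (s / M * (CN * CH * L ^ 2 * (8 / δ + r₀)) * c ^ 2) ≤
      L ^ 2 * (c ^ 2 * (8 / δ + 1) + 1) * ((nK + 1) * s * ((CN + 1) * CH * (1 + r₀))) * M⁻¹ := by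
    have hCN1 : CN ≤ CN + 1 := by linarith
    have ha : CN * CH * L ^ 2 * (8 / δ + r₀) * c ^ 2 ≤ (CN + 1) * CH * L ^ 2 * ((8 / δ + 1) * (1 + r₀)) * c ^ 2 := by
      have hb : CN * CH * L ^ 2 ≤ (CN + 1) * CH * L ^ 2 := by gcongr
      have hc0 : 0 ≤ (CN + 1) * CH * L ^ 2 := by positivity
      exact mul_le_mul_of_nonneg_right (mul_le_mul hb h8 (by positivity) hc0) (sq_nonneg _)
    have hd : (CN + 1) * CH * L ^ 2 * ((8 / δ + 1) * (1 + r₀)) * c ^ 2 ≤ L ^ 2 * (c ^ 2 * (8 / δ + 1) + 1) * ((CN + 1) * CH * (1 + r₀)) := by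
      have e : (CN + 1) * CH * L ^ 2 * ((8 / δ + 1) * (1 + r₀)) * c ^ 2 = L ^ 2 * (c ^ 2 * (8 / δ + 1)) * ((CN + 1) * CH * (1 + r₀)) := by ring
      rw [e]
      exact mul_le_mul_of_nonneg_right (mul_le_mul_of_nonneg_left (by linarith) hL2) (by positivity)
    have hk : 0 ≤ ((nK : ℝ) + 1) * (s / M) := by positivity
    calc ((nK : ℝ) + 1) * (s / M * (CN * CH * L ^ 2 * (8 / δ + r₀)) * c ^ 2)
        = ((nK : ℝ) + 1) * (s / M) * (CN * CH * L ^ 2 * (8 / δ + r₀) * c ^ 2) := by ring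
      _ ≤ ((nK : ℝ) + 1) * (s / M) * (L ^ 2 * (c ^ 2 * (8 / δ + 1) + 1) * ((CN + 1) * CH * (1 + r₀))) :=
          mul_le_mul_of_nonneg_left (ha.trans hd) hk
      _ = _ := by rw [div_eq_mul_inv]; ring
  -- term 3
  have h3 : CD * Real.exp (-(cD * M)) * CH * L ^ 2 * c ^ 2 ≤ L ^ 2 * (c ^ 2 * (8 / δ + 1) + 1) * (CD * CH / cD) * M⁻¹ := by
    have he : Real.exp (-(cD * M)) ≤ (cD * M)⁻¹ := exp_neg_le_inv' (mul_pos hcD hM)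
    have ha : CD * Real.exp (-(cD * M)) * CH * L ^ 2 * c ^ 2 ≤ CD * (cD * M)⁻¹ * CH * L ^ 2 * c ^ 2 := by
      have h0 : 0 ≤ CH * L ^ 2 * c ^ 2 := by positivity
      calc CD * Real.exp (-(cD * M)) * CH * L ^ 2 * c ^ 2 = CD * Real.exp (-(cD * M)) * (CH * L ^ 2 * c ^ 2) := by ring
        _ ≤ CD * (cD * M)⁻¹ * (CH * L ^ 2 * c ^ 2) := mul_le_mul_of_nonneg_right (mul_le_mul_of_nonneg_left he hCD) h0
        _ = _ := by ring
    have hb : CD * (cD * M)⁻¹ * CH * L ^ 2 * c ^ 2 = L ^ 2 * c ^ 2 * (CD * CH / cD) * M⁻¹ := by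
      field_simp
    have hc' : L ^ 2 * c ^ 2 * (CD * CH / cD) * M⁻¹ ≤ L ^ 2 * (c ^ 2 * (8 / δ + 1) + 1) * (CD * CH / cD) * M⁻¹ := by
      have h0 : 0 ≤ CD * CH / cD := by positivity
      have hcc : c ^ 2 ≤ c ^ 2 * (8 / δ + 1) + 1 := by
        have : 0 ≤ c ^ 2 * (8 / δ) := by positivity
        nlinarith
      have := mul_le_mul_of_nonneg_left hcc hL2
      exact mul_le_mul_of_nonneg_right (mul_le_mul_of_nonneg_right (by linarith) h0) (inv_nonneg.2 hM.le)
    linarith [ha, hb.le, hb.ge, hc']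
  have hsum : L ^ 2 * (c ^ 2 * (8 / δ + 1) + 1) * (nE * (s₁ * C₁) + s₂ * CG) * M⁻¹ +
      L ^ 2 * (c ^ 2 * (8 / δ + 1) + 1) * ((nK + 1) * s * ((CN + 1) * CH * (1 + r₀))) * M⁻¹ +
      L ^ 2 * (c ^ 2 * (8 / δ + 1) + 1) * (CD * CH / cD) * M⁻¹ =
      L ^ 2 * (c ^ 2 * (8 / δ + 1) + 1) * (nE * (s₁ * C₁) + s₂ * CG + (nK + 1) * s * ((CN + 1) * CH * (1 + r₀)) + CD * CH / cD) * M⁻¹ := by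
    ring
  linarith [h1, h2, h3, hsum.le]

/-! ## §2  The reversed diagonal term `h_□G_□K̃_{□,□}` on the torus -/

/-- **(2.134) FOR THE REVERSED DIAGONAL TERM `h_□G_□K̃_{□,□}` ON THE GENUINE MULTI-LEVEL TORUS, `K̃_{□,□} = kDiagT` BY NAME, THE `O(M⁻¹)` EXPLICIT, WITH
THE INDICATORS `1_{□̃}(y)1_{□̃}(y′)`.**  For every rate `δ > 0` there are a threshold `M₀` and `Θ ≥ 0` (on `d, L, δ` only) such that for every genuine nested
family `D` with `L·M_h ≥ M₀` and every cube datum of the displayed shapes (the INPUT-side decomposition `hdecT` of `[M_□, h_□]`, the local legs `G_□`,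
`G_□∘E_e`, the global OUT-leg `h_□G_□`, coefficient sizes read at the input bond, the block-Lipschitz `h_□`, partners `N_k`, `P_□` In/Out-localised over `T`
with the inputs of `h_□M_□` over `U = □̃`, `supp ζ_□ ⊂ □̃`, the transposed line 3): `HasMajorant blk (h_□G_□K̃_{□,□}) (1_U(y)1_U(y′)·Θ·U·M⁻¹·e^{−(δ/2)d})`,
`U = #E·s₁C₁ + s₂C_G + (#K+1)·s·((C_N+1)C_H(1+r₀)) + C_DC_H/c_D`. [cite: Balaban1984PropagatorsII, (2.134) p.247; (2.92) p.239; (2.133) p.247; Lemma 2.1 (2.60), (2.63) p.234] -/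
theorem ineq2134T_kDiag_torus (d ℓ : ℕ) {δ : ℝ} (hδ : 0 < δ) :
    ∃ M₀ Θ : ℝ, 0 < M₀ ∧ 0 ≤ Θ ∧
      ∀ {Mh k R : ℕ} {P : Fin (d + 1) → ℕ} (D : TDomains d ℓ Mh k P R), 1 ≤ Mh → (∀ μ, 1 ≤ P μ) → 2 * (ℓ + 1) ≤ R →
        M₀ ≤ ((ℓ : ℝ) + 1) * Mh → ∀ {X : Type} (blk : X → (geomTB D).Site) (Dg : Module.End ℝ (X → ℝ)),
        ∀ {CG CH C₁ CN CD cD s s₁ s₂ r₀ : ℝ}, 0 ≤ CG → 0 ≤ CH → 0 ≤ C₁ → 0 ≤ CN → 0 ≤ CD → 0 < cD → 0 ≤ s → 0 ≤ s₁ → 0 ≤ s₂ → 0 ≤ r₀ →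
        ∀ {Gl Ml Pl : Module.End ℝ (X → ℝ)} {hI c₀ ζ : X → ℝ} {S T U : Set (geomTB D).Site}
          {ι : Type} (DE : Finset ι) {E : ι → Module.End ℝ (X → ℝ)} {cf : ι → X → ℝ}
          {κ : Type} (DK : Finset κ) {N : κ → Module.End ℝ (X → ℝ)} {z : κ → X → ℝ},
          Ml * mulOp hI - mulOp hI * Ml =
            (∑ e ∈ DE, E e * mulOp (cf e) - mulOp c₀) + ∑ k ∈ DK, (mulOp hI * N k - N k * mulOp hI) * mulOp (z k) →
          LocalMajorant blk Gl S (fun y y' => CG * (geomTB D).len y ^ 2 * Real.exp (-(δ * (geomTB D).dist y y'))) →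
          (∀ e ∈ DE, LocalMajorant blk (Gl * E e) S (fun y y' => C₁ * (geomTB D).len y ^ 2 * Real.exp (-(δ * (geomTB D).dist y y')))) →
          HasMajorant blk (mulOp hI * Gl) (fun y y'' => CH * (geomTB D).len y ^ 2 * Real.exp (-(δ * (geomTB D).dist y y''))) →
          (∀ e ∈ DE, ∀ x, |cf e x| ≤ s₁ / ((geomTB D).M * (geomTB D).len (blk x) ^ 2)) → (∀ e ∈ DE, ∀ x, cf e x ≠ 0 → blk x ∈ S) →
          (∀ x, |c₀ x| ≤ s₂ / ((geomTB D).M * (geomTB D).len (blk x) ^ 2)) → (∀ x, c₀ x ≠ 0 → blk x ∈ S) →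
          (∀ x, |hI x| ≤ 1) → (∀ x, hI x ≠ 0 → blk x ∈ S) → S ⊆ T → S ⊆ U →
          (∀ x x', |hI x' - hI x| ≤ s / (geomTB D).M * ((geomTB D).dist (blk x) (blk x') + r₀)) →
          (∀ k ∈ DK, InMajorant blk (N k) T (fun y y'' => CN / (geomTB D).len y ^ 2 * Real.exp (-(δ * (geomTB D).dist y y'')))) →
          (∀ k ∈ DK, ∀ (y'' : (geomTB D).Site) (μ : X → ℝ) (B : ℝ), BlockSupp blk μ y'' B → ∀ x, blk x ∈ T →
            |N k μ x| ≤ CN / (geomTB D).len (blk x) ^ 2 * Real.exp (-(δ * (geomTB D).dist (blk x) y'')) * B) →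
          (∀ k ∈ DK, ∀ x, |z k x| ≤ 1) → InLoc blk (mulOp hI * Ml) U →
          InMajorant blk Pl T (fun y y'' => CN / (geomTB D).len y ^ 2 * Real.exp (-(δ * (geomTB D).dist y y''))) →
          (∀ (y'' : (geomTB D).Site) (μ : X → ℝ) (B : ℝ), BlockSupp blk μ y'' B → ∀ x, blk x ∈ T →
            |Pl μ x| ≤ CN / (geomTB D).len (blk x) ^ 2 * Real.exp (-(δ * (geomTB D).dist (blk x) y'')) * B) →
          (∀ x, |ζ x| ≤ 1) → (∀ x, ζ x ≠ 0 → blk x ∈ U) →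
          HasMajorant blk (mulOp hI * (Dg - Pl) * mulOp ζ)
            (fun y y'' => CD * Real.exp (-(cD * (geomTB D).M)) / (geomTB D).len y ^ 2 * Real.exp (-(δ * (geomTB D).dist y y''))) →
          HasMajorant blk (mulOp hI * Gl * kDiagT Dg (mulOp hI) (mulOp ζ) Ml Pl)
            (fun y y' => ind U y * ind U y' *
              (Θ * (DE.card * (s₁ * C₁) + s₂ * CG + (DK.card + 1) * s * ((CN + 1) * CH * (1 + r₀)) + CD * CH / cD) *
                ((geomTB D).M)⁻¹ * Real.exp (-(δ / 2 * (geomTB D).dist y y')))) := by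
  obtain ⟨N₀, hN₀pos, h263⟩ := ineq263_geomTB d ℓ hδ
  obtain ⟨N₂, hthr⟩ := thr_geomTB d ℓ hδ
  obtain ⟨c, hc⟩ : ∃ c : ℝ, c = K261 N₀ (d + 1) ((ℓ : ℝ) + 1) 1 (1 / 3 * (3 / 4 * δ)) := ⟨_, rfl⟩
  obtain ⟨M₀, hM₀⟩ : ∃ M₀ : ℝ, M₀ = max ((N₀ : ℝ) + 1) ((N₂ : ℝ) + 1) := ⟨_, rfl⟩
  obtain ⟨Θ, hΘ⟩ : ∃ Θ : ℝ, Θ = ((ℓ : ℝ) + 1) ^ 2 * (c ^ 2 * (8 / δ + 1) + 1) := ⟨_, rfl⟩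
  have hΘnn : 0 ≤ Θ := by rw [hΘ]; positivity
  refine ⟨M₀, Θ, by rw [hM₀]; exact lt_max_of_lt_left (by positivity), hΘnn, ?_⟩
  intro Mh k R P D hMh hP hR hM X blk Dg CG CH C₁ CN CD cD s s₁ s₂ r₀ hCG hCH hC₁ hCN hCD hcD hs hs₁ hs₂ hr₀ Gl Ml Pl hI c₀ ζ S T U ι DE E cf κ DK N z
    hdecT hG hGE hHG hcf hcfS hc₀ hc₀S hI1 hIS hST hSU hLip hNin hNout hz hMin hPlin hPlout hζ hζU hD3
  have hMN₀ : (N₀ : ℝ) + 1 ≤ ((ℓ : ℝ) + 1) * Mh := (le_max_left _ _).trans (hM₀ ▸ hM)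
  have hMN₂ : (N₂ : ℝ) + 1 ≤ ((ℓ : ℝ) + 1) * Mh := (le_max_right _ _).trans (hM₀ ▸ hM)
  have hMpos := M_pos_TB D hMh
  have h263D : Ineq263With c (geomTB D) (3 / 4 * δ) (1 / 3) := by rw [hc]; exact h263 D hMh hP hR hMN₀
  -- `K̃_{□,□}` by name: its compact form (for the input localisation) and its decomposed form (for the majorant, by `hdecT`)
  have e : mulOp hI * Gl * kDiagT Dg (mulOp hI) (mulOp ζ) Ml Pl =
      mulOp hI * (Gl * ((Ml * mulOp hI - mulOp hI * Ml) + mulOp hI * (Dg - Pl) * mulOp ζ + (mulOp hI * Pl - Pl * mulOp hI) * mulOp ζ)) := by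
    simp only [kDiagT, mul_assoc]
  rw [e]
  have hin := compactT_inLoc blk (Gl := Gl) (Dg := Dg) (Pl := Pl) hSU hIS hMin hζU
  rw [mul_assoc (mulOp hI) Gl] at hin
  have key0 := diagT_hasMajorant blk (one_le_L_TB D) (eta_pos_TB D) (levelSepTB D hMh hP (one_le_RLMh hMh hR)) (dist_nonneg_TB D hMh hP)
    hδ hCG hCH hC₁ hCN hCD hs hs₁ hs₂ hr₀ hMpos (RM_nonneg_TB D hMh hR) (hthr D hMh hR hMN₂) h263D DE DK hG hGE hHG hcf hcfS hc₀ hc₀S hI1 hIS hST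
    hLip hNin hNout hz hPlin hPlout hζ hD3
  have key : HasMajorant blk
      (mulOp hI * (Gl * ((Ml * mulOp hI - mulOp hI * Ml) + mulOp hI * (Dg - Pl) * mulOp ζ + (mulOp hI * Pl - Pl * mulOp hI) * mulOp ζ)))
      (fun y y' => (((DE.card : ℝ) * (s₁ * C₁) + s₂ * CG) * (geomTB D).L ^ 2 / (geomTB D).M +
          ((DK.card : ℝ) + 1) * (s / (geomTB D).M * (CN * CH * (geomTB D).L ^ 2 * (8 / δ + r₀)) * c ^ 2) +
            CD * Real.exp (-(cD * (geomTB D).M)) * CH * (geomTB D).L ^ 2 * c ^ 2) * Real.exp (-(1 / 2 * δ * (geomTB D).dist y y'))) := by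
    rw [hdecT, ← mul_assoc (mulOp hI) Gl]
    exact key0
  have hK : ∀ y y' : (geomTB D).Site, 0 ≤ (((DE.card : ℝ) * (s₁ * C₁) + s₂ * CG) * (geomTB D).L ^ 2 / (geomTB D).M +
      ((DK.card : ℝ) + 1) * (s / (geomTB D).M * (CN * CH * (geomTB D).L ^ 2 * (8 / δ + r₀)) * c ^ 2) +
        CD * Real.exp (-(cD * (geomTB D).M)) * CH * (geomTB D).L ^ 2 * c ^ 2) * Real.exp (-(1 / 2 * δ * (geomTB D).dist y y')) := by
    intro y y'; have := hMpos; positivity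
  refine hasMajorant_mono _ (hasMajorant_indOutIn blk hK key (fun x hx => hSU (hIS x hx)) hin) fun y y' => ?_
  refine mul_le_mul_of_nonneg_left ?_ (mul_nonneg (ind_nonneg _ _) (ind_nonneg _ _))
  have hθ := thetaT_pack_le (L := (geomTB D).L) (c := c) (CH := CH) DE.card DK.card hMpos hδ hCN hCG hCH hC₁ hCD hcD hs hs₁ hs₂ hr₀
  rw [geomTB_L] at hθ ⊢
  rw [← hΘ] at hθ
  have h1 : Real.exp (-(1 / 2 * δ * (geomTB D).dist y y')) = Real.exp (-(δ / 2 * (geomTB D).dist y y')) := by ring_nf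
  rw [h1]
  exact mul_le_mul_of_nonneg_right hθ (Real.exp_nonneg _)

/-! ## §3  The reversed off-diagonal term `h_{□′}G_{□′}K̃_{□,□′}` on the torus -/

/-- algebra of multiplication operators: `(1 − ζ)·h·h = (1 − ζ)·(h²)·` as operators. [cite: Balaban1984PropagatorsII, (2.93) p.239, bookkeeping] -/
private theorem one_sub_mulOp_mul {X : Type} (z h : X → ℝ) :
    (1 - mulOp z) * (mulOp h * mulOp h) = mulOp (fun x => 1 - z x) * mulOp (fun x => h x * h x) := by
  refine LinearMap.ext fun v => funext fun x => ?_
  simp only [Module.End.mul_apply, LinearMap.sub_apply, Module.End.one_apply, Pi.sub_apply, mulOp_apply]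
  ring

/-- **(2.134) FOR THE REVERSED OFF-DIAGONAL TERM `h_{□′}G_{□′}K̃_{□,□′}` (□ ≠ □′) ON THE TORUS, `K̃_{□,□′} = kOffT` BY NAME, WITH THE INDICATORS
`1_{□̃′}(y)1_{□̃}(y′)`**: under the (2.88)-shape majorant of `∂P∂*`, the global OUT-leg `h_{□′}G_{□′}`, `|h_□| ≤ 1` supported over `U_□`, `0 ≤ ζ_{□′} ≤ 1` with
`ζ_{□′} = 1` on the blocks of `Score′`, `|h_{□′}| ≤ 1` supported over `S′ ⊆ U_{□′}`, and the gap `mM` read from the inside out — above ONE threshold: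
`HasMajorant blk (h_{□′}G_{□′}K̃_{□,□′}) (1_{U′}(y)1_U(y′)·Θ·C_PC_H/(mM)·e^{−(δ/2)d})`. [cite: Balaban1984PropagatorsII, (2.134) p.247; (2.93) p.239; (2.88) p.238; Lemma 2.1 p.234] -/
theorem ineq2134T_kOff_torus (d ℓ : ℕ) {δ : ℝ} (hδ : 0 < δ) :
    ∃ M₀ Θ : ℝ, 0 < M₀ ∧ 0 ≤ Θ ∧
      ∀ {Mh k R : ℕ} {P : Fin (d + 1) → ℕ} (D : TDomains d ℓ Mh k P R), 1 ≤ Mh → (∀ μ, 1 ≤ P μ) → 2 * (ℓ + 1) ≤ R →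
        M₀ ≤ ((ℓ : ℝ) + 1) * Mh → ∀ {X : Type} (blk : X → (geomTB D).Site) {CP CH m : ℝ}, 0 ≤ CP → 0 ≤ CH → 0 < m →
        ∀ {Dg GJ : Module.End ℝ (X → ℝ)} {hJ zJ hI : X → ℝ} {S Score UJ UI : Set (geomTB D).Site},
          HasMajorant blk Dg (fun y y'' => CP / (geomTB D).len y ^ 2 * Real.exp (-(δ * (geomTB D).dist y y''))) →
          HasMajorant blk (mulOp hJ * GJ) (fun y y'' => CH * (geomTB D).len y ^ 2 * Real.exp (-(δ * (geomTB D).dist y y''))) →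
          (∀ x, |hJ x| ≤ 1) → (∀ x, hJ x ≠ 0 → blk x ∈ S) → S ⊆ UJ →
          (∀ x, 0 ≤ zJ x) → (∀ x, zJ x ≤ 1) → (∀ x, zJ x ≠ 1 → blk x ∉ Score) →
          (∀ x, |hI x| ≤ 1) → (∀ x, hI x ≠ 0 → blk x ∈ UI) →
          (∀ y'' b, y'' ∈ S → b ∉ Score → m * (geomTB D).M ≤ (geomTB D).dist y'' b) →
          HasMajorant blk (mulOp hJ * GJ * kOffT Dg (mulOp hI) (mulOp zJ) (mulOp hJ))
            (fun y y' => ind UJ y * ind UI y' * (Θ * CP * CH / m * ((geomTB D).M)⁻¹ * Real.exp (-(δ / 2 * (geomTB D).dist y y')))) := by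
  obtain ⟨N₀, hN₀pos, h263⟩ := ineq263_geomTB d ℓ hδ
  obtain ⟨N₂, hthr⟩ := thr_geomTB d ℓ hδ
  obtain ⟨c, hc⟩ : ∃ c : ℝ, c = K261 N₀ (d + 1) ((ℓ : ℝ) + 1) 1 (1 / 3 * (3 / 4 * δ)) := ⟨_, rfl⟩
  obtain ⟨M₀, hM₀⟩ : ∃ M₀ : ℝ, M₀ = max ((N₀ : ℝ) + 1) ((N₂ : ℝ) + 1) := ⟨_, rfl⟩
  obtain ⟨Θ, hΘ⟩ : ∃ Θ : ℝ, Θ = 8 * ((ℓ : ℝ) + 1) ^ 2 * c ^ 2 / δ := ⟨_, rfl⟩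
  have hΘnn : 0 ≤ Θ := by rw [hΘ]; positivity
  refine ⟨M₀, Θ, by rw [hM₀]; exact lt_max_of_lt_left (by positivity), hΘnn, ?_⟩
  intro Mh k R P D hMh hP hR hM X blk CP CH m hCP hCH hm Dg GJ hJ zJ hI S Score UJ UI hDg hHG hJ1 hJS hSU hz0 hz1 hzS hI1 hIU hgap
  have hMN₀ : (N₀ : ℝ) + 1 ≤ ((ℓ : ℝ) + 1) * Mh := (le_max_left _ _).trans (hM₀ ▸ hM)
  have hMN₂ : (N₂ : ℝ) + 1 ≤ ((ℓ : ℝ) + 1) * Mh := (le_max_right _ _).trans (hM₀ ▸ hM)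
  have hMpos := M_pos_TB D hMh
  have h263D : Ineq263With c (geomTB D) (3 / 4 * δ) (1 / 3) := by rw [hc]; exact h263 D hMh hP hR hMN₀
  -- `K̃_{□,□′}` by name, as the sandwich `(h_{□′}·∂P∂*·(1 − ζ_{□′}))·h_□²`
  have e : mulOp hJ * GJ * kOffT Dg (mulOp hI) (mulOp zJ) (mulOp hJ) =
      mulOp hJ * GJ * (mulOp hJ * Dg * mulOp (fun x => 1 - zJ x)) * mulOp (fun x => hI x * hI x) := by
    simp only [kOffT, mul_assoc]
    rw [one_sub_mulOp_mul]
  rw [e]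
  have hw1 : ∀ x, |1 - zJ x| ≤ 1 := fun x => by
    rw [abs_le]; constructor <;> linarith [hz0 x, hz1 x]
  have hwS : ∀ x, 1 - zJ x ≠ 0 → blk x ∉ Score := fun x hx => hzS x fun h1 => hx (by rw [h1, sub_self])
  have ha1 : ∀ x, |hI x * hI x| ≤ 1 := fun x => by
    rw [abs_mul]; nlinarith [abs_nonneg (hI x), hI1 x]
  have haU : ∀ x, hI x * hI x ≠ 0 → blk x ∈ UI := fun x hx => hIU x (fun h0 => hx (by rw [h0, mul_zero]))
  have key := offDiagT_hasMajorant_ind blk (one_le_L_TB D) (eta_pos_TB D) (levelSepTB D hMh hP (one_le_RLMh hMh hR)) (dist_nonneg_TB D hMh hP)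
    hδ.le hCP hCH (RM_nonneg_TB D hMh hR) (hthr D hMh hR hMN₂) h263D hDg hHG hJ1 hJS hSU hw1 hwS ha1 haU hgap
  refine hasMajorant_mono _ key fun y y' => ?_
  refine mul_le_mul_of_nonneg_left ?_ (mul_nonneg (ind_nonneg _ _) (ind_nonneg _ _))
  have hθ := theta_le (L := (geomTB D).L) (c := c) hδ hm hMpos hCP hCH
  have hid : 8 * CP * CH * (geomTB D).L ^ 2 * c ^ 2 / (δ * m) = Θ * CP * CH / m := by rw [hΘ, geomTB_L]; field_simp
  rw [hid] at hθ
  have h1 : Real.exp (-(1 / 2 * δ * (geomTB D).dist y y')) = Real.exp (-(δ / 2 * (geomTB D).dist y y')) := by ring_nf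
  rw [h1]
  exact mul_le_mul_of_nonneg_right hθ (Real.exp_nonneg _)

/-! ## §4  All pairs of the reversed family, one threshold, one `Θ` -/

/-- `a ≤ (a + 1)(b + 1)` for `a, b ≥ 0`. [cite: Balaban1984PropagatorsII, (2.134) p.247, bookkeeping] -/
private theorem le_mul_succ_left {a b : ℝ} (ha : 0 ≤ a) (hb : 0 ≤ b) : a ≤ (a + 1) * (b + 1) := by nlinarith

open Classical in
/-- **(2.134) FOR THE WHOLE REVERSED FAMILY `h_{□′}G_{□′}K̃_{□,□′}` ON THE GENUINE MULTI-LEVEL TORUS — ALL PAIRS, ONE THRESHOLD `M₀`, ONE `Θ`** (the mirror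
of p38 gen 27's `h2134_kFam_torus_in`): boxes `𝒟` with per-cube data `h_□, ζ_□, G_□, M_□, P_□`, sets `S_□ ⊆ T_□ ⊆ U_□ = □̃`, `Score_□`, the reversed family
`K̃ = kFamT` BY NAME; hypotheses: the INPUT-side decomposition `hdecT` of `[M_□, h_□]`, the local legs `G_□`, `G_□∘E_e`, the global OUT-legs `h_□G_□`, the
coefficient sizes/supports, `h_□` block-Lipschitz, partners `N_k`, `P_□` In/Out-localised over `T_□`, the input localisation `InLoc (h_□M_□) U_□`,
`0 ≤ ζ_□ ≤ 1`, `supp ζ_□ ⊂ U_□`, `ζ_□ = 1` on `Score_□`, the transposed line 3 per cube, the gap `mM` read from the inside out, the (2.88)-shape `∂P∂*`; then for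
all members above ONE threshold and all pairs: `HasMajorant blk (h_{□′}G_{□′}K̃_{□,□′}) (1_{U′}(y)1_U(y′)·θ₀·e^{−(δ/2)d})`, `θ₀ = Θ·(C_PC_H/m + U)/M`.
[cite: Balaban1984PropagatorsII, (2.134)–(2.135) p.247; (2.91)–(2.93) p.239; (2.133) p.247; Lemma 2.1 p.234] -/
theorem h2134T_kFamT_torus (d ℓ : ℕ) {δG : ℝ} (hδG : 0 < δG) :
    ∃ M₀ Θ : ℝ, 0 < M₀ ∧ 0 ≤ Θ ∧
      ∀ {Mh k R : ℕ} {P : Fin (d + 1) → ℕ} (D : TDomains d ℓ Mh k P R), 1 ≤ Mh → (∀ μ, 1 ≤ P μ) → 2 * (ℓ + 1) ≤ R →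
        M₀ ≤ ((ℓ : ℝ) + 1) * Mh → ∀ {X : Type} (blk : X → (geomTB D).Site) {Dg : Module.End ℝ (X → ℝ)} {CP : ℝ}, 0 ≤ CP →
        HasMajorant blk Dg (fun y y'' => CP / (geomTB D).len y ^ 2 * Real.exp (-(δG * (geomTB D).dist y y''))) →
        ∀ {CG CH C₁ CN CD cD s s₁ s₂ r₀ m : ℝ}, 0 ≤ CG → 0 ≤ CH → 0 ≤ C₁ → 0 ≤ CN → 0 ≤ CD → 0 < cD → 0 ≤ s → 0 ≤ s₁ → 0 ≤ s₂ → 0 ≤ r₀ → 0 < m →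
        ∀ (nE nK : ℕ) {C : Type} [DecidableEq C] (Dc : Finset C) {G Ml Pl : C → Module.End ℝ (X → ℝ)} {h ζ c₀ : C → X → ℝ}
          {T S U Score : C → Set (geomTB D).Site}
          {ι : Type} {DE : C → Finset ι} {E : C → ι → Module.End ℝ (X → ℝ)} {cf : C → ι → X → ℝ}
          {κ : Type} {DK : C → Finset κ} {N : C → κ → Module.End ℝ (X → ℝ)} {z : C → κ → X → ℝ},
          (∀ c ∈ Dc, (DE c).card ≤ nE) → (∀ c ∈ Dc, (DK c).card ≤ nK) →
          (∀ c ∈ Dc, Ml c * mulOp (h c) - mulOp (h c) * Ml c =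
            (∑ e ∈ DE c, E c e * mulOp (cf c e) - mulOp (c₀ c)) + ∑ k ∈ DK c, (mulOp (h c) * N c k - N c k * mulOp (h c)) * mulOp (z c k)) →
          (∀ c ∈ Dc, LocalMajorant blk (G c) (S c) (fun y y' => CG * (geomTB D).len y ^ 2 * Real.exp (-(δG * (geomTB D).dist y y')))) →
          (∀ c ∈ Dc, ∀ e ∈ DE c,
            LocalMajorant blk (G c * E c e) (S c) (fun y y' => C₁ * (geomTB D).len y ^ 2 * Real.exp (-(δG * (geomTB D).dist y y')))) →
          (∀ c ∈ Dc, HasMajorant blk (mulOp (h c) * G c) (fun y y'' => CH * (geomTB D).len y ^ 2 * Real.exp (-(δG * (geomTB D).dist y y'')))) →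
          (∀ c ∈ Dc, ∀ e ∈ DE c, ∀ x, |cf c e x| ≤ s₁ / ((geomTB D).M * (geomTB D).len (blk x) ^ 2)) →
          (∀ c ∈ Dc, ∀ e ∈ DE c, ∀ x, cf c e x ≠ 0 → blk x ∈ S c) →
          (∀ c ∈ Dc, ∀ x, |c₀ c x| ≤ s₂ / ((geomTB D).M * (geomTB D).len (blk x) ^ 2)) → (∀ c ∈ Dc, ∀ x, c₀ c x ≠ 0 → blk x ∈ S c) →
          (∀ c ∈ Dc, ∀ x, |h c x| ≤ 1) → (∀ c ∈ Dc, ∀ x, h c x ≠ 0 → blk x ∈ S c) → (∀ c ∈ Dc, S c ⊆ T c) → (∀ c ∈ Dc, S c ⊆ U c) →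
          (∀ c ∈ Dc, ∀ x x', |h c x' - h c x| ≤ s / (geomTB D).M * ((geomTB D).dist (blk x) (blk x') + r₀)) →
          (∀ c ∈ Dc, ∀ k ∈ DK c,
            InMajorant blk (N c k) (T c) (fun y y'' => CN / (geomTB D).len y ^ 2 * Real.exp (-(δG * (geomTB D).dist y y'')))) →
          (∀ c ∈ Dc, ∀ k ∈ DK c, ∀ (y'' : (geomTB D).Site) (μ : X → ℝ) (B : ℝ), BlockSupp blk μ y'' B → ∀ x, blk x ∈ T c →
            |N c k μ x| ≤ CN / (geomTB D).len (blk x) ^ 2 * Real.exp (-(δG * (geomTB D).dist (blk x) y'')) * B) →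
          (∀ c ∈ Dc, ∀ k ∈ DK c, ∀ x, |z c k x| ≤ 1) → (∀ c ∈ Dc, InLoc blk (mulOp (h c) * Ml c) (U c)) →
          (∀ c ∈ Dc, InMajorant blk (Pl c) (T c) (fun y y'' => CN / (geomTB D).len y ^ 2 * Real.exp (-(δG * (geomTB D).dist y y'')))) →
          (∀ c ∈ Dc, ∀ (y'' : (geomTB D).Site) (μ : X → ℝ) (B : ℝ), BlockSupp blk μ y'' B → ∀ x, blk x ∈ T c →
            |Pl c μ x| ≤ CN / (geomTB D).len (blk x) ^ 2 * Real.exp (-(δG * (geomTB D).dist (blk x) y'')) * B) →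
          (∀ c ∈ Dc, ∀ x, 0 ≤ ζ c x) → (∀ c ∈ Dc, ∀ x, ζ c x ≤ 1) → (∀ c ∈ Dc, ∀ x, ζ c x ≠ 0 → blk x ∈ U c) →
          (∀ c ∈ Dc, ∀ x, ζ c x ≠ 1 → blk x ∉ Score c) →
          (∀ c ∈ Dc, HasMajorant blk (mulOp (h c) * (Dg - Pl c) * mulOp (ζ c))
            (fun y y'' => CD * Real.exp (-(cD * (geomTB D).M)) / (geomTB D).len y ^ 2 * Real.exp (-(δG * (geomTB D).dist y y'')))) →
          (∀ c ∈ Dc, ∀ y'' b, y'' ∈ S c → b ∉ Score c → m * (geomTB D).M ≤ (geomTB D).dist y'' b) →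
          ∀ c ∈ Dc, ∀ c' ∈ Dc,
            HasMajorant blk
              (mulOp (h c') * G c' * kFamT Dg (fun c => mulOp (h c)) (fun c => mulOp (ζ c)) Ml Pl c c')
              (fun y y' => ind (U c') y * ind (U c) y' *
                (Θ * (CP * CH / m + (nE * (s₁ * C₁) + s₂ * CG + (nK + 1) * s * ((CN + 1) * CH * (1 + r₀)) + CD * CH / cD)) *
                  ((geomTB D).M)⁻¹ * Real.exp (-(δG / 2 * (geomTB D).dist y y')))) := by
  obtain ⟨M₁, Θ₁, hM₁, hΘ₁, hoff⟩ := ineq2134T_kOff_torus d ℓ hδG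
  obtain ⟨M₂, Θ₂, hM₂, hΘ₂, hdiag⟩ := ineq2134T_kDiag_torus d ℓ hδG
  refine ⟨max M₁ M₂, max Θ₁ Θ₂, lt_max_of_lt_left hM₁, le_max_of_le_left hΘ₁, ?_⟩
  intro Mh k R P D hMh hP hR hM X blk Dg CP hCP hDg CG CH C₁ CN CD cD s s₁ s₂ r₀ m hCG hCH hC₁ hCN hCD hcD hs hs₁ hs₂ hr₀ hm nE nK C _ Dc G Ml Pl h ζ c₀
    T S U Score ι DE E cf κ DK N z hnE hnK hdecT hG hGE hHG hcf hcfS hc₀ hc₀S hh1 hhS hST hSU hLip hNin hNout hz hMin hPlin hPlout hζ0 hζ1 hζU hζS hD3 hgap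
    c hc c' hc'
  have hMi1 : M₁ ≤ ((ℓ : ℝ) + 1) * Mh := (le_max_left _ _).trans hM
  have hMi2 : M₂ ≤ ((ℓ : ℝ) + 1) * Mh := (le_max_right _ _).trans hM
  have hMpos : 0 < (geomTB D).M := M_pos_TB D hMh
  have hMinv : 0 ≤ ((geomTB D).M)⁻¹ := inv_nonneg.2 hMpos.le
  set Upk : ℝ := nE * (s₁ * C₁) + s₂ * CG + (nK + 1) * s * ((CN + 1) * CH * (1 + r₀)) + CD * CH / cD with hU
  have hUnn : 0 ≤ Upk := by rw [hU]; positivity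
  have hV : 0 ≤ CP * CH / m := div_nonneg (mul_nonneg hCP hCH) hm.le
  have hind0 : ∀ y y' : (geomTB D).Site, 0 ≤ ind (U c') y * ind (U c) y' := fun y y' => mul_nonneg (ind_nonneg _ _) (ind_nonneg _ _)
  -- the common kernel dominates both packs
  have hdom : ∀ {θ : ℝ} (y y' : (geomTB D).Site), 0 ≤ θ → θ ≤ max Θ₁ Θ₂ * (CP * CH / m + Upk) →
      ind (U c') y * ind (U c) y' * (θ * ((geomTB D).M)⁻¹ * Real.exp (-(δG / 2 * (geomTB D).dist y y'))) ≤
        ind (U c') y * ind (U c) y' * (max Θ₁ Θ₂ * (CP * CH / m + Upk) * ((geomTB D).M)⁻¹ * Real.exp (-(δG / 2 * (geomTB D).dist y y'))) := by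
    intro θ y y' hθ hθle
    exact mul_le_mul_of_nonneg_left (mul_le_mul_of_nonneg_right (mul_le_mul_of_nonneg_right hθle hMinv) (Real.exp_nonneg _)) (hind0 y y')
  have hζabs : ∀ x, |ζ c' x| ≤ 1 := fun x => abs_le.2 ⟨by linarith [hζ0 c' hc' x], hζ1 c' hc' x⟩
  by_cases hcc : c = c'
  · -- the diagonal pair: `kDiagT`
    subst hcc
    rw [kFamT_of_eq]
    have key := hdiag D hMh hP hR hMi2 blk Dg hCG hCH hC₁ hCN hCD hcD hs hs₁ hs₂ hr₀ (DE c) (DK c) (hdecT c hc) (hG c hc) (hGE c hc) (hHG c hc)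
      (hcf c hc) (hcfS c hc) (hc₀ c hc) (hc₀S c hc) (hh1 c hc) (hhS c hc) (hST c hc) (hSU c hc) (hLip c hc) (hNin c hc) (hNout c hc) (hz c hc) (hMin c hc)
      (hPlin c hc) (hPlout c hc) hζabs (hζU c hc) (hD3 c hc)
    refine hasMajorant_mono _ key fun y y' => ?_
    have hUc : ((DE c).card : ℝ) * (s₁ * C₁) + s₂ * CG + ((DK c).card + 1) * s * ((CN + 1) * CH * (1 + r₀)) + CD * CH / cD ≤ Upk := by
      have h1 : ((DE c).card : ℝ) ≤ nE := by exact_mod_cast hnE c hc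
      have h2 : ((DK c).card : ℝ) ≤ nK := by exact_mod_cast hnK c hc
      have h3 : 0 ≤ s₁ * C₁ := by positivity
      have h4 : 0 ≤ s * ((CN + 1) * CH * (1 + r₀)) := by positivity
      rw [hU]; nlinarith
    have hUc0 : 0 ≤ ((DE c).card : ℝ) * (s₁ * C₁) + s₂ * CG + ((DK c).card + 1) * s * ((CN + 1) * CH * (1 + r₀)) + CD * CH / cD := by positivity
    refine hdom y y' (mul_nonneg hΘ₂ hUc0) ?_
    calc Θ₂ * (((DE c).card : ℝ) * (s₁ * C₁) + s₂ * CG + ((DK c).card + 1) * s * ((CN + 1) * CH * (1 + r₀)) + CD * CH / cD)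
        ≤ max Θ₁ Θ₂ * Upk := mul_le_mul (le_max_right _ _) hUc hUc0 (le_trans hΘ₁ (le_max_left _ _))
      _ ≤ max Θ₁ Θ₂ * (CP * CH / m + Upk) := mul_le_mul_of_nonneg_left (by linarith) (le_trans hΘ₁ (le_max_left _ _))
  · -- an off-diagonal pair: `kOffT`
    rw [kFamT_of_ne _ _ _ _ _ hcc]
    have key := hoff D hMh hP hR hMi1 blk hCP hCH hm (Dg := Dg) (GJ := G c') (S := S c') (Score := Score c') (UJ := U c') (UI := U c) hDg (hHG c' hc')
      (hh1 c' hc') (hhS c' hc') (hSU c' hc') (hζ0 c' hc') (hζ1 c' hc') (hζS c' hc') (hh1 c hc) (fun x hx => hSU c hc (hhS c hc x hx)) (hgap c' hc')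
    refine hasMajorant_mono _ key fun y y' => ?_
    have e1 : Θ₁ * CP * CH / m = Θ₁ * (CP * CH / m) := by ring
    rw [e1]
    refine hdom y y' (mul_nonneg hΘ₁ hV) ?_
    calc Θ₁ * (CP * CH / m) ≤ max Θ₁ Θ₂ * (CP * CH / m) := mul_le_mul_of_nonneg_right (le_max_left _ _) hV
      _ ≤ max Θ₁ Θ₂ * (CP * CH / m + Upk) := mul_le_mul_of_nonneg_left (by linarith) (le_trans hΘ₁ (le_max_left _ _))

end Literature.MathematicalPhysics.QuantumFieldTheory.Balaban1983to89.B6Ineq2134TransposeKLevelTorus
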